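import Summits.QuantumFields.YangMills.Theorems.LuscherReductionTwistedTraceScalingToronCell
import Summits.QuantumFields.YangMills.Theorems.LuscherReductionTwistedTraceScalingStepActionExact
import HarnessLib

/-!
# COERCIVITY of the action near a twisted flat background: the spectral DICHOTOMY `aᵢ = 0 ∨ aᵢ ≥ m(θ')` of `‖D_{V_θ}·‖²` and the two-sided expansion
# `S(W·V) = ‖D_V w‖² ± N_P(29376τ³ + 700569τ⁴)` at a FLAT row point (lane A of S-BASE, crux `TwistedTraceScaling` stmt-QuantumFields-20203; first bricks of
# the geometry statement C3c-LOW, design note `pub/ym-fleet/ym-luscher-20007-p1/COARSE-DESIGN.md` §15 (C3))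

C3c-LOW («a valley point of small action is `√S/δ`-close, modulo gauge, to a twisted flat `V_θ'` with `θ'` in the cell and away from the torons») has a LOCAL half —
coercivity of `S` transverse to the flat family — and a GLOBAL half (Łojasiewicz `dist(U, Flat) ≲ S^{1/4}`, the brick that survives the disprover's R8/R9).  This file
types the local half in LinkSpace:
* §1 ★ `Frame.IsDiag.value_zero_or_ge` — for every orthonormal frame `(e, a)` diagonalising `‖D_{V_θ}·‖²` and every `m > 0` below the charged values
  (`∀ j, lap3 L (2θ) j = 0 ∨ m ≤ lap3 L (2θ) j`) and below the neutral gap (`m ≤ 2 − 2cos(2π/L)`): EVERY value is `0` or `≥ m` (frame transport with the indicator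
  of `(0, m)` against the explicit plane-wave frame; the neutral sector through its complexification);  `cellFloor L θ' = min(lap3 L (2θ') 0, 2 − 2cos(π/L))` does it
  for a cell representative `θ'` (`|θ'_k| ≤ π/(2L)`) off the torons (`value_zero_or_ge_cellFloor`, from `R9.cell_gap_le_lap3`);
* §2 ★ `Frame.IsDiag.norm_sq_ge_of_dichotomy` — COERCIVITY: `‖D v‖² ≥ m·(‖v‖² − Σ_{i : aᵢ = 0} ⟪eᵢ, v⟫²)` (the form controls the component off the zero modes
  = gauge ⊕ valley tangent);
* §3 ★★ `abs_wilsonAction_flatStep_sub_le` — at a FLAT row point `V` (`S(V) = 0`: `F(V) = 0`, `c_p = 1`) the exact expansion of `…StepActionExact` has NO linear and NO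
  `√σ` term: `|S(W·V) − ‖D_V(linkVec W)‖²| ≤ N_P(29376τ³ + 700569τ⁴)` for link steps in the upper hemisphere with components `≤ τ ≤ 1/30`; with §1–§2 at
  `V = V_θ'`: ★★ `wilsonAction_flatStep_ge_coercive`: `S(W·V_θ') ≥ m(θ')·(‖w‖² − Σ_{zero modes}⟪eᵢ,w⟫²) − N_P(29376τ³ + 700569τ⁴)`.
So a point `U = W·V_θ'` with transverse displacement `w_⊥` has `‖w_⊥‖² ≤ (S(U) + N_P(29376τ³+700569τ⁴))/m(θ')`, `m(θ') ≥ min(4Σ_k sin²θ'_k, 2−2cos(π/L)) ≳ δ²/L⁶` in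
the valley — the quantitative «small action ⇒ close to the flat family» ONCE the step `τ` is a priori small (the global half and the optimal choice of `(g, θ')`, which
makes the tangential part of the step second order, are NOT here).
HONEST FRAMING: finite-dimensional linear algebra / quaternion bookkeeping for a stub lane of a child of the CONDITIONAL reduction route (femto rung R2b1); not Clay.
-/

set_option autoImplicit false

noncomputable section

open Finset Real Module
open scoped BigOperators InnerProductSpace RealInnerProductSpace
open Literature.MathematicalPhysics.QuantumFieldTheory
open Literature.MathematicalPhysics.QuantumLattice
open Summit.QuantumFields.YangMills.Theorems.TwistedTraceScaling.Negative

namespace Summit.QuantumFields.YangMills.Theorems.FemtoTransferGap.TwoLattice.Toron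

open Summit.QuantumFields.YangMills.Theorems.FemtoTransferGap
open Summit.QuantumFields.YangMills.Theorems.FemtoTransferGap.TwoLattice
open Summit.QuantumFields.YangMills.Theorems.FemtoTransferGap.TwoLattice.Stiff
open Summit.QuantumFields.YangMills.Theorems.FemtoTransferGap.TwoLattice.Cov

variable (L : ℕ) [NeZero L]

/-! ## §1 The spectral dichotomy of `‖D_{V_θ}·‖²` -/

/-- The indicator of the open gap `(0, m)`: `gapInd m y = 1` if `0 < y < m`, else `0`. [folklore] -/
def gapInd (m y : ℝ) : ℝ := if 0 < y ∧ y < m then 1 else 0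

omit [NeZero L] in
/-- `gapInd ≥ 0`. [folklore] -/
theorem gapInd_nonneg (m y : ℝ) : 0 ≤ gapInd m y := by
  unfold gapInd; split_ifs <;> norm_num

omit [NeZero L] in
/-- `gapInd m y = 0` iff `y` is not in the gap. [folklore] -/
theorem gapInd_eq_zero_iff (m y : ℝ) : gapInd m y = 0 ↔ ¬ (0 < y ∧ y < m) := by
  unfold gapInd; split_ifs with h <;> simp [h]

omit [NeZero L] in
/-- A value that is `0` or `≥ m` is not in the gap. [folklore] -/
theorem gapInd_eq_zero_of_dichotomy {m y : ℝ} (h : y = 0 ∨ m ≤ y) : gapInd m y = 0 := by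
  rw [gapInd_eq_zero_iff]
  rintro ⟨h1, h2⟩
  rcases h with h | h
  · rw [h] at h1; exact lt_irrefl _ h1
  · linarith

/-- The plane-wave values at twist `φ` avoid the gap `(0, m)` when every `lap3 L φ j` does. [folklore] -/
theorem gapInd_pwValue_eq_zero {φ : Fin 3 → ℝ} {m : ℝ} (hφ : ∀ j : Fin 3 → Fin L, lap3 L φ j = 0 ∨ m ≤ lap3 L φ j) (idx : Site 3 L × Fin 3) :
    gapInd m (pwValue L φ idx) = 0 := by
  obtain ⟨j, s⟩ := idx
  unfold pwValue
  by_cases hs : s = 0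
  · simp only [hs, if_true]; exact gapInd_eq_zero_of_dichotomy (Or.inl rfl)
  · simp only [hs, if_false]
    rw [norm_qhat_sq_eq_lap3_equiv]
    exact gapInd_eq_zero_of_dichotomy (hφ _)

/-- At zero twist the only vanishing `lap3` is at zero momentum; the others are `≥ 2 − 2cos(2π/L)`. [folklore] -/
theorem lap3_zero_dichotomy (hL : 2 ≤ L) (j : Fin 3 → Fin L) : lap3 L 0 j = 0 ∨ 2 - 2 * Real.cos (2 * Real.pi / L) ≤ lap3 L 0 j := by
  by_cases hj : j = 0
  · left
    rw [hj, lap3_zero_momentum]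
    simp
  · right
    have := hL
    exact gap_le_lap3 L hj

/-- ★ **SPECTRAL DICHOTOMY at a flat background.**  Let `m > 0` lie below every non-zero charged value (`∀ j, lap3 L (2θ) j = 0 ∨ m ≤ lap3 L (2θ) j`) and below the
neutral gap (`m ≤ 2 − 2cos(2π/L)`, `L ≥ 2`).  Then EVERY orthonormal frame `(e, a)` diagonalising `‖D_{V_θ}·‖²` has, for every `i`, `aᵢ = 0 ∨ m ≤ aᵢ`.
[cite: HornJohnson2013, Thm 2.5.4] [cite: Luscher1983, §3] -/
theorem Frame.IsDiag.value_zero_or_ge (hL : 2 ≤ L) {θ : Fin 3 → ℝ} {m : ℝ}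
    (hch : ∀ j : Fin 3 → Fin L, lap3 L (fun k => 2 * θ k) j = 0 ∨ m ≤ lap3 L (fun k => 2 * θ k) j) (hne : m ≤ 2 - 2 * Real.cos (2 * Real.pi / L))
    {ι : Type*} [Fintype ι] [DecidableEq ι] {e : OrthonormalBasis ι ℝ (LinkSpace L)} {a : ι → ℝ}
    (h : Frame.IsDiag (covCurl (abelianCfg L θ)) e a) (i : ι) : a i = 0 ∨ m ≤ a i := by
  classical
  -- the explicit frame has no value in the gap
  have hneutral : ∑ i', gapInd m (neutralValue L i') = 0 := by
    rw [(isDiag_cplxFrame L (isDiag_neutralFrame L)).sum_eq_sum (isDiag_twCurl_pwFrame L 0) (gapInd m)]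
    refine Finset.sum_eq_zero fun idx _ => gapInd_pwValue_eq_zero L (fun j => ?_) idx
    rcases lap3_zero_dichotomy L hL j with h0 | h0
    · exact Or.inl h0
    · exact Or.inr (hne.trans h0)
  have hexplicit : ∑ I, gapInd m (linkValue L θ I) = 0 := by
    rw [Fintype.sum_sum_type, Fintype.sum_sum_type]
    have h2 : ∑ idx, gapInd m (linkValue L θ (Sum.inr (Sum.inl idx))) = 0 :=
      Finset.sum_eq_zero fun idx _ => gapInd_pwValue_eq_zero L hch idx
    have h3 : ∑ idx, gapInd m (linkValue L θ (Sum.inr (Sum.inr idx))) = 0 :=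
      Finset.sum_eq_zero fun idx _ => gapInd_pwValue_eq_zero L hch idx
    have h1 : ∑ i', gapInd m (linkValue L θ (Sum.inl i')) = 0 := hneutral
    rw [h1, h2, h3]; ring
  -- transport to the given frame
  have hsum : ∑ i', gapInd m (a i') = 0 := by rw [h.sum_eq_sum (isDiag_linkFrame L θ) (gapInd m), hexplicit]
  have hi : gapInd m (a i) = 0 := (Finset.sum_eq_zero_iff_of_nonneg fun i' _ => gapInd_nonneg m (a i')).mp hsum i (Finset.mem_univ i)
  rw [gapInd_eq_zero_iff] at hi
  have ha0 := h.nonneg i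
  by_contra hcon
  push Not at hcon
  exact hi ⟨lt_of_le_of_ne ha0 (Ne.symm hcon.1), hcon.2⟩

/-- **The cell floor** `m(θ') = min(lap3 L (2θ') 0, 2 − 2cos(π/L))`: the softest non-zero stiffness at a cell representative `θ'` off the torons. [folklore] -/
def cellFloor (θ' : Fin 3 → ℝ) : ℝ := min (lap3 L (fun k => 2 * θ' k) 0) (2 - 2 * Real.cos (Real.pi / L))

omit [NeZero L] in
/-- `cos(2π/L) ≤ cos(π/L)` for `L ≥ 2`, i.e. the neutral gap dominates the cell gap. [folklore] -/
theorem cell_gap_le_neutral_gap (hL : 2 ≤ L) : 2 - 2 * Real.cos (Real.pi / L) ≤ 2 - 2 * Real.cos (2 * Real.pi / L) := by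
  have hL' : (2 : ℝ) ≤ L := by exact_mod_cast hL
  have hLpos : (0 : ℝ) < L := by linarith
  have h1 : 0 ≤ Real.pi / L := by positivity
  have h2 : Real.pi / L ≤ 2 * Real.pi / L := by rw [div_le_div_iff_of_pos_right hLpos]; linarith [Real.pi_pos]
  have h3 : 2 * Real.pi / L ≤ Real.pi := by rw [div_le_iff₀ hLpos]; nlinarith [Real.pi_pos]
  have := Real.cos_le_cos_of_nonneg_of_le_pi h1 h3 h2
  linarith

/-- ★ **Dichotomy with the cell floor**: for a cell representative `θ'` (`|θ'_k| ≤ π/(2L)`) off the torons (`lap3 L (2θ') 0 ≠ 0`) and `L ≥ 2`, every value of every frame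
diagonalising `‖D_{V_θ'}·‖²` is `0` or `≥ cellFloor L θ'`, and `cellFloor L θ' > 0`. [cite: Luscher1983, §3] -/
theorem Frame.IsDiag.value_zero_or_ge_cellFloor (hL : 2 ≤ L) {θ' : Fin 3 → ℝ} (hcell : ∀ k, |θ' k| ≤ Real.pi / (2 * L))
    (hoff : lap3 L (fun k => 2 * θ' k) 0 ≠ 0) {ι : Type*} [Fintype ι] [DecidableEq ι] {e : OrthonormalBasis ι ℝ (LinkSpace L)} {a : ι → ℝ}
    (h : Frame.IsDiag (covCurl (abelianCfg L θ')) e a) (i : ι) : 0 < cellFloor L θ' ∧ (a i = 0 ∨ cellFloor L θ' ≤ a i) := by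
  have hpos : 0 < cellFloor L θ' := lt_min (lt_of_le_of_ne (lap3_nonneg L _ _) (Ne.symm hoff)) (R9.cell_gap_pos L hL)
  refine ⟨hpos, h.value_zero_or_ge L hL (fun j => ?_) ((min_le_right _ _).trans (cell_gap_le_neutral_gap L hL)) i⟩
  by_cases hj : j = 0
  · right; rw [hj]; exact min_le_left _ _
  · right; exact (min_le_right _ _).trans (R9.cell_gap_le_lap3 L hL (fun k => abs_two_mul_le_of_cell L hcell k) hj)

/-! ## §2 Coercivity off the zero modes -/

/-- ★ **COERCIVITY from the dichotomy**: if `(e, a)` diagonalises `‖D·‖²` with `aᵢ = 0 ∨ m ≤ aᵢ` (`m ≥ 0`), then for every `v`,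
`m·(‖v‖² − Σ_{i : aᵢ = 0}⟪eᵢ,v⟫²) ≤ ‖D v‖²` (no sign needed on `m`). [cite: HornJohnson2013, Thm 4.1.5] -/
theorem Frame.IsDiag.norm_sq_ge_of_dichotomy {E F : Type*} [NormedAddCommGroup E] [InnerProductSpace ℝ E] [NormedAddCommGroup F] [InnerProductSpace ℝ F]
    {ι : Type*} [Fintype ι] [DecidableEq ι] {D : E →ₗ[ℝ] F} {e : OrthonormalBasis ι ℝ E} {a : ι → ℝ} (h : Frame.IsDiag D e a) {m : ℝ}
    (hdich : ∀ i, a i = 0 ∨ m ≤ a i) (v : E) :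
    m * (‖v‖ ^ 2 - ∑ i ∈ univ.filter (fun i => a i = 0), ⟪e i, v⟫_ℝ ^ 2) ≤ ‖D v‖ ^ 2 := by
  classical
  rw [h.norm_sq_eq_sum_real v, ← e.sum_sq_inner_left v]
  have hsplit := (Finset.sum_filter_add_sum_filter_not univ (fun i => a i = 0) (fun i => ⟪e i, v⟫_ℝ ^ 2)).symm
  -- `⟪v, eᵢ⟫ = ⟪eᵢ, v⟫`
  have hsym : ∑ i, ⟪v, e i⟫_ℝ ^ 2 = ∑ i, ⟪e i, v⟫_ℝ ^ 2 := Finset.sum_congr rfl fun i _ => by rw [real_inner_comm]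
  rw [hsym, hsplit, add_sub_cancel_left, Finset.mul_sum]
  rw [← Finset.sum_filter_add_sum_filter_not univ (fun i => a i = 0) (fun i => a i * ⟪e i, v⟫_ℝ ^ 2)]
  have h0 : ∑ i ∈ univ.filter (fun i => a i = 0), a i * ⟪e i, v⟫_ℝ ^ 2 = 0 :=
    Finset.sum_eq_zero fun i hi => by rw [(Finset.mem_filter.mp hi).2, zero_mul]
  rw [h0, zero_add]
  refine Finset.sum_le_sum fun i hi => ?_
  have hai : m ≤ a i := by
    rcases hdich i with h1 | h1
    · exact absurd h1 (Finset.mem_filter.mp hi).2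
    · exact h1
  exact mul_le_mul_of_nonneg_right hai (sq_nonneg _)

/-! ## §3 The action near a FLAT row point: two-sided by the stiff form, no linear term -/

variable {L}

/-- At a flat configuration every plaquette holonomy has scalar part `1` and zero curvature vector. [folklore] -/
theorem flat_plaquette {V : GaugeConfig 3 L SU2} (hV : wilsonAction su2Rep V = 0) (p : Plaquette 3 L) :
    scalarPart (hol V p) = 1 ∧ ∀ c, plaqCurv V (p, c) = 0 := by
  rw [wilsonAction_eq_sum_scalarPart] at hV
  have hterm : ∀ q : Plaquette 3 L, 0 ≤ 2 * (1 - scalarPart (hol V q)) := fun q => by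
    have h := scalarPart_sq_add (hol V q)
    have h2 : 0 ≤ ∑ a, vecPart (hol V q) a ^ 2 := Finset.sum_nonneg fun a _ => sq_nonneg _
    nlinarith
  have hp := (Finset.sum_eq_zero_iff_of_nonneg fun q _ => hterm q).mp hV p (Finset.mem_univ p)
  have hc : scalarPart (hol V p) = 1 := by linarith
  refine ⟨hc, fun c => ?_⟩
  rw [plaqCurv_apply]
  have h := scalarPart_sq_add (hol V p)
  rw [hc, one_pow] at h
  have hsum : ∑ a, vecPart (hol V p) a ^ 2 = 0 := by linarith
  exact pow_eq_zero_iff two_ne_zero |>.mp ((Finset.sum_eq_zero_iff_of_nonneg fun a _ => sq_nonneg _).mp hsum c (Finset.mem_univ c))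

/-- ★★ **The action one kinetic step away from a FLAT point** (`S(V) = 0`; link steps in the upper hemisphere with components `≤ τ ≤ 1/30`):
`|S(W·V) − ‖D_V(linkVec W)‖²| ≤ N_P(29376τ³ + 700569τ⁴)` — the exact expansion of `…StepActionExact` with `F(V) = 0`, `c_p = 1`, `σ = 0`. [cite: Luscher1983, §3] -/
theorem abs_wilsonAction_flatStep_sub_le (W V : GaugeConfig 3 L SU2) (hV : wilsonAction su2Rep V = 0) {τ : ℝ} (hτ : τ ≤ 1 / 30)
    (hs : ∀ e : Edge 3 L, 0 ≤ scalarPart (W e)) (hw : ∀ (e : Edge 3 L) (c : Fin 3), |vecPart (W e) c| ≤ τ) :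
    |wilsonAction su2Rep (W * V) - ‖covCurl V (linkVec L W)‖ ^ 2| ≤
      (Fintype.card (Plaquette 3 L) : ℝ) * (29376 * τ ^ 3 + 700569 * τ ^ 4) := by
  have h := abs_wilsonAction_step_sub_quadratic_le W V hτ (by norm_num : (0 : ℝ) < 2) hV.le hs hw
  have hlin : ∑ p : Plaquette 3 L, ∑ c, covCurl V (linkVec L W) (p, c) * plaqCurv V (p, c) = 0 :=
    Finset.sum_eq_zero fun p _ => Finset.sum_eq_zero fun c _ => by rw [(flat_plaquette hV p).2 c, mul_zero]
  have hquad : ∑ p : Plaquette 3 L, scalarPart (hol V p) * ∑ c, covCurl V (linkVec L W) (p, c) ^ 2 = ‖covCurl V (linkVec L W)‖ ^ 2 := by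
    rw [← sum_covCurl_sq_eq_norm_sq]
    exact Finset.sum_congr rfl fun p _ => by rw [(flat_plaquette hV p).1, one_mul]
  rw [hlin, hquad, hV, mul_zero, sub_zero, sub_zero] at h
  refine h.trans (le_of_eq ?_)
  unfold stepActionErr
  rw [Real.sqrt_zero, mul_zero, zero_add]

/-- ★★ **COERCIVE LOWER BOUND near a twisted flat background.**  For `L ≥ 2`, a cell representative `θ'` off the torons, any orthonormal frame `(e, a)` diagonalising
`‖D_{V_θ'}·‖²`, and a kinetic step `W` (upper hemisphere, components `≤ τ ≤ 1/30`):
`cellFloor L θ' · (‖w‖² − Σ_{i : aᵢ = 0}⟪eᵢ, w⟫²) − N_P(29376τ³ + 700569τ⁴) ≤ S(W·V_θ')`, `w = linkVec W` — the action controls the displacement off the zero modes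
(gauge ⊕ valley tangent). [cite: Luscher1983, §3] -/
theorem wilsonAction_flatStep_ge_coercive (hL : 2 ≤ L) {θ' : Fin 3 → ℝ} (hcell : ∀ k, |θ' k| ≤ Real.pi / (2 * L))
    (hoff : lap3 L (fun k => 2 * θ' k) 0 ≠ 0) {ι : Type*} [Fintype ι] [DecidableEq ι] {e : OrthonormalBasis ι ℝ (LinkSpace L)} {a : ι → ℝ}
    (h : Frame.IsDiag (covCurl (abelianCfg L θ')) e a) (W : GaugeConfig 3 L SU2) {τ : ℝ} (hτ : τ ≤ 1 / 30)
    (hs : ∀ e : Edge 3 L, 0 ≤ scalarPart (W e)) (hw : ∀ (e : Edge 3 L) (c : Fin 3), |vecPart (W e) c| ≤ τ) :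
    cellFloor L θ' * (‖linkVec L W‖ ^ 2 - ∑ i ∈ univ.filter (fun i => a i = 0), ⟪e i, linkVec L W⟫_ℝ ^ 2) -
        (Fintype.card (Plaquette 3 L) : ℝ) * (29376 * τ ^ 3 + 700569 * τ ^ 4) ≤
      wilsonAction su2Rep (W * abelianCfg L θ') := by
  have hd := fun i => (h.value_zero_or_ge_cellFloor L hL hcell hoff i).2
  have hpos : 0 < cellFloor L θ' := lt_min (lt_of_le_of_ne (lap3_nonneg L _ _) (Ne.symm hoff)) (R9.cell_gap_pos L hL)
  have hco := h.norm_sq_ge_of_dichotomy hd (linkVec L W)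
  have hstep := abs_wilsonAction_flatStep_sub_le W (abelianCfg L θ') (wilsonAction_abelianCfg (L := L) θ') hτ hs hw
  have := (abs_le.mp hstep).1
  linarith

end Summit.QuantumFields.YangMills.Theorems.FemtoTransferGap.TwoLattice.Toron

end
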